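import Mathlib
import Summits.NavierStokesRegularity.NavierStokesRegularity.Theorems.L3TimeExponentPincerRingPersistenceFloor
import Summits.NavierStokesRegularity.NavierStokesRegularity.Theorems.L3TimeExponentPincerQuantJaw
import Literature.Analysis.FluidPDE.AxisymmetricNoSwirlGlobalHolds
import HarnessLib.Audit
import HarnessLib

/-!
# L3TimeExponentPincer — ring persistence: packaging into `LpPersistence 3 (1/2) 2`
# from a RING DATUM FAMILY (the interface the explicit datum must meet)

Support kernel for the crux `L3CascadeJaw` (item stmt-NavierStokesRegularity-19499).  The dynamic
Persistence Lemma is in the tree (`…RingPersistenceFloor.l3_floor`: for a Tao-class solution from an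
axisymmetric swirl-free datum with `|η₀| ≤ M`, `∫|η₀| ≤ m`, `∫η₀⁻ ≤ m⁻`, `∫ r²η₀^± ≤ P`,
`∫|u₀|² ≥ E`, the `L³` norm stays above `(π(E/2)³/(512(√m√(4P))³))^{1/3}` as long as
`2t·6√(M√m)√(m⁻) ≤ √(√(2P))/2` and `16νMPt ≤ E`).  This file reduces the typed target
`LpPersistence 3 (1/2) 2` of `L3TimeExponentPincerQuantJaw` (whose negation of the uniform
quantitative jaw, `not_quantJaw_of_ringPersistence`, it feeds) to the EXISTENCE OF A RING DATUM
FAMILY: one constant `c ∈ (0, 1]` and, for every scale `ℓ ∈ (0, 1]`, a smooth divergence-free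
rapidly decaying axisymmetric swirl-free datum `u₀` with `∫|u₀|² ≤ 1` together with numbers
`M, m, m⁻, P, E` satisfying the datum bounds and the three scale inequalities
(window `2(cℓ²)·6√(M√m)√(m⁻) ≤ √(√(2P))/2`, energy `16 M P (cℓ²) ≤ E`, floor
`c ℓ^{-1/2} ≤ (π(E/2)³/(512(√m√(4P))³))^{1/3}`) — `lpPersistence_of_ringData`.  Global existence in
Tao's class is the tree theorem `exists_isTaoSolutionOn_of_noSwirl` (Ladyzhenskaya /
Ukhovskii–Yudovich; `tao2011_smooth_local_existence_holds`, `axisymmetricNoSwirl_enstrophy_apriori_holds`).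
The explicit family (a smooth Hill-type dipole vortex `curl (F_ℓ(|x|²) χ · Jx)`, `M ≍ ℓ^{-7/2}`,
`m ≍ ℓ^{-1/2}`, `m⁻ ≍ P ≍ ℓ^{3/2}`, `E ≍ 1`) is the remaining sequel.

* `RingData` is NOT a definition here: the hypothesis is spelled out in the theorem statement.
* `not_quantJaw_of_ringData` — the jaw has no constant, conditional on the datum family.

WHAT THIS IS NOT: not a statement about blow-up; conditional on the datum family (no named fact).
-/

namespace Summit.NavierStokesRegularity.NavierStokesRegularity.Theorems.L3TimeExponentPincerRingPersistence

open MeasureTheory Set Real Literature.Analysis.FluidPDE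
open Summit.NavierStokesRegularity.NavierStokesRegularity.Theorems.L3TimeExponentPincerQuantJaw
open Summit.NavierStokesRegularity.NavierStokesRegularity.Theorems.L3TimeExponentPincerRingPersistenceFloor
open scoped ENNReal NNReal

/-- **`LpPersistence 3 (1/2) 2` from a ring datum family.**  Suppose there is `c ∈ (0, 1]` such
that for every `ℓ ∈ (0, 1]` there are a datum `u₀ : ℝ³ → ℝ³` — smooth, divergence free, rapidly
decaying, axisymmetric without swirl, with `η₀ = angVortQuot u₀ ∈ L¹` and `∫⁻|u₀|² ≤ 1` — and
numbers `M, m, m⁻, P, E` with `|η₀| ≤ M`, `∫|η₀| ≤ m`, `0 < m`, `∫⁻η₀⁻ ≤ m⁻`, `0 ≤ m⁻`, `0 < P`,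
`∫⁻ r²η₀^± ≤ P`, `0 < E`, `ofReal E ≤ ∫⁻|u₀|²`, and the scale inequalities
`2(cℓ²)·6√(M√m)√(m⁻) ≤ √(√(2P))/2`, `16 M P (cℓ²) ≤ E`,
`c ℓ^{-1/2} ≤ (π(E/2)³/(512(√m√(4P))³))^{1/3}`.  Then `LpPersistence 3 (1/2) 2` holds: the
Tao-class solution from `u₀` (global regularity of swirl-free axisymmetric flows) is a frame
solution on `[0, 1)` with energy `≤ 1` whose `L³` norm stays `≥ c ℓ^{-1/2}` on `(0, cℓ²)`. -/
theorem lpPersistence_of_ringData {c : ℝ} (hc : 0 < c) (hc1 : c ≤ 1)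
    (hdata : ∀ ℓ : ℝ, 0 < ℓ → ℓ ≤ 1 →
      ∃ (u₀ : EuclideanSpace ℝ (Fin 3) → EuclideanSpace ℝ (Fin 3)) (M m mneg P E : ℝ),
        ContDiff ℝ (⊤ : ℕ∞) u₀ ∧ VectorCalculus.IsDivFree u₀ ∧ HasRapidSpatialDecay u₀ ∧
        IsAxisymmetric u₀ ∧ HasNoSwirl u₀ ∧ Integrable (angVortQuot u₀) ∧
        (∫⁻ x, ‖u₀ x‖ₑ ^ 2 ≤ 1) ∧
        (∀ x, |angVortQuot u₀ x| ≤ M) ∧ (∫ x, |angVortQuot u₀ x| ≤ m) ∧ 0 < m ∧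
        (∫⁻ x, ENNReal.ofReal ((angVortQuot u₀ x)⁻) ≤ ENNReal.ofReal mneg) ∧ 0 ≤ mneg ∧ 0 < P ∧
        (∫⁻ x, ENNReal.ofReal (cylRadius x ^ 2 * (angVortQuot u₀ x)⁺) ≤ ENNReal.ofReal P) ∧
        (∫⁻ x, ENNReal.ofReal (cylRadius x ^ 2 * (angVortQuot u₀ x)⁻) ≤ ENNReal.ofReal P) ∧
        0 < E ∧ (ENNReal.ofReal E ≤ ∫⁻ x, ‖u₀ x‖ₑ ^ 2) ∧
        2 * (c * ℓ ^ (2 : ℝ)) * (6 * Real.sqrt (M * Real.sqrt m) * Real.sqrt mneg) ≤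
          Real.sqrt (Real.sqrt (2 * P)) / 2 ∧
        16 * M * P * (c * ℓ ^ (2 : ℝ)) ≤ E ∧
        c * ℓ ^ (-(1 / 2 : ℝ)) ≤
          (π * (E / 2) ^ 3 / (512 * (Real.sqrt m * Real.sqrt (4 * P)) ^ 3)) ^ (1 / 3 : ℝ)) :
    LpPersistence 3 (1 / 2) 2 := by
  refine ⟨c, hc, hc1, fun ℓ hℓ hℓ1 => ?_⟩
  obtain ⟨u₀, M, m, mneg, P, E, hsm, hdiv, hdec, hax, hsw, hL1, hE1, hM, hm, hm0, hmneg, hmneg0,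
    hP, hPp, hPn, hE, hEu, hW1, hW2, hF⟩ := hdata ℓ hℓ hℓ1
  -- the global Tao-class solution on `[0, 1]`
  obtain ⟨u, p, hsol⟩ := exists_isTaoSolutionOn_of_noSwirl tao2011_smooth_local_existence_holds
    axisymmetricNoSwirl_enstrophy_apriori_holds one_pos hsm hdiv
    (fun n => hdec.lintegral_enorm_iteratedFDeriv_sq_lt_top (μ := volume) n) hax hsw one_pos
  refine ⟨u, p, ⟨?_, ?_, ?_⟩, ?_, ?_⟩
  · exact hsol.classical.mono Ico_subset_Icc_self (uniqueDiffOn_Ico 0 1)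
  · have := hsol.isLerayHopfOn one_pos
    rwa [← hsol.initial] at this
  · rw [hsol.initial]; exact hdec
  · show ∫⁻ x, ‖u 0 x‖ₑ ^ 2 ≤ 1
    rw [hsol.initial]; exact hE1
  · intro t ht
    -- the window `τ = c ℓ²`
    have hℓ2 : 0 < ℓ ^ (2 : ℝ) := Real.rpow_pos_of_pos hℓ _
    have hτpos : 0 < c * ℓ ^ (2 : ℝ) := mul_pos hc hℓ2
    have hτ1 : c * ℓ ^ (2 : ℝ) ≤ 1 := by
      calc c * ℓ ^ (2 : ℝ) ≤ 1 * 1 :=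
            mul_le_mul hc1 (Real.rpow_le_one hℓ.le hℓ1 (by norm_num)) hℓ2.le zero_le_one
        _ = 1 := one_mul _
    have hτ : c * ℓ ^ (2 : ℝ) ∈ Ioc (0 : ℝ) 1 := ⟨hτpos, hτ1⟩
    have htI : t ∈ Icc 0 (c * ℓ ^ (2 : ℝ)) := ⟨ht.1.le, ht.2.le⟩
    have hM0 : 0 ≤ M := (abs_nonneg _).trans (hM 0)
    have htE : 16 * (1 : ℝ) * M * P * t ≤ E := by
      have : 16 * M * P * t ≤ 16 * M * P * (c * ℓ ^ (2 : ℝ)) :=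
        mul_le_mul_of_nonneg_left ht.2.le (by positivity)
      linarith
    have hfl := l3_floor hsol one_pos one_pos hax hsw hL1 hM hm0 hm hmneg hmneg0 hP hPp hPn hτ hW1
      hE hEu htI htE
    exact (ENNReal.ofReal_le_ofReal hF).trans hfl

/-- **The jaw has no constant, conditional on the ring datum family.**  Under the hypothesis of
`lpPersistence_of_ringData`, the uniform quantitative jaw `QuantJaw q` fails for every `q > 4`
(`not_quantJaw_of_ringPersistence`). -/
theorem not_quantJaw_of_ringData {c : ℝ} (hc : 0 < c) (hc1 : c ≤ 1)
    (hdata : ∀ ℓ : ℝ, 0 < ℓ → ℓ ≤ 1 →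
      ∃ (u₀ : EuclideanSpace ℝ (Fin 3) → EuclideanSpace ℝ (Fin 3)) (M m mneg P E : ℝ),
        ContDiff ℝ (⊤ : ℕ∞) u₀ ∧ VectorCalculus.IsDivFree u₀ ∧ HasRapidSpatialDecay u₀ ∧
        IsAxisymmetric u₀ ∧ HasNoSwirl u₀ ∧ Integrable (angVortQuot u₀) ∧
        (∫⁻ x, ‖u₀ x‖ₑ ^ 2 ≤ 1) ∧
        (∀ x, |angVortQuot u₀ x| ≤ M) ∧ (∫ x, |angVortQuot u₀ x| ≤ m) ∧ 0 < m ∧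
        (∫⁻ x, ENNReal.ofReal ((angVortQuot u₀ x)⁻) ≤ ENNReal.ofReal mneg) ∧ 0 ≤ mneg ∧ 0 < P ∧
        (∫⁻ x, ENNReal.ofReal (cylRadius x ^ 2 * (angVortQuot u₀ x)⁺) ≤ ENNReal.ofReal P) ∧
        (∫⁻ x, ENNReal.ofReal (cylRadius x ^ 2 * (angVortQuot u₀ x)⁻) ≤ ENNReal.ofReal P) ∧
        0 < E ∧ (ENNReal.ofReal E ≤ ∫⁻ x, ‖u₀ x‖ₑ ^ 2) ∧
        2 * (c * ℓ ^ (2 : ℝ)) * (6 * Real.sqrt (M * Real.sqrt m) * Real.sqrt mneg) ≤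
          Real.sqrt (Real.sqrt (2 * P)) / 2 ∧
        16 * M * P * (c * ℓ ^ (2 : ℝ)) ≤ E ∧
        c * ℓ ^ (-(1 / 2 : ℝ)) ≤
          (π * (E / 2) ^ 3 / (512 * (Real.sqrt m * Real.sqrt (4 * P)) ^ 3)) ^ (1 / 3 : ℝ))
    {q : ℝ} (hq : 4 < q) : ¬ QuantJaw q :=
  not_quantJaw_of_ringPersistence (lpPersistence_of_ringData hc hc1 hdata) hq

/-- **`LpPersistence 3 (1/2) a` from a datum family with window exponent `a`** (general lifetime
exponent; `a = 2` is `lpPersistence_of_ringData`, `a = 5/2` = one turnover is what a generic compact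
vortex blob gives).  Same hypotheses with the window `c ℓ^a` (`0 ≤ a`) in the two time-scale
inequalities; conclusion `LpPersistence 3 (1/2) a`. -/
theorem lpPersistence_of_ringData_exp {c a : ℝ} (hc : 0 < c) (hc1 : c ≤ 1) (ha : 0 ≤ a)
    (hdata : ∀ ℓ : ℝ, 0 < ℓ → ℓ ≤ 1 →
      ∃ (u₀ : EuclideanSpace ℝ (Fin 3) → EuclideanSpace ℝ (Fin 3)) (M m mneg P E : ℝ),
        ContDiff ℝ (⊤ : ℕ∞) u₀ ∧ VectorCalculus.IsDivFree u₀ ∧ HasRapidSpatialDecay u₀ ∧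
        IsAxisymmetric u₀ ∧ HasNoSwirl u₀ ∧ Integrable (angVortQuot u₀) ∧
        (∫⁻ x, ‖u₀ x‖ₑ ^ 2 ≤ 1) ∧
        (∀ x, |angVortQuot u₀ x| ≤ M) ∧ (∫ x, |angVortQuot u₀ x| ≤ m) ∧ 0 < m ∧
        (∫⁻ x, ENNReal.ofReal ((angVortQuot u₀ x)⁻) ≤ ENNReal.ofReal mneg) ∧ 0 ≤ mneg ∧ 0 < P ∧
        (∫⁻ x, ENNReal.ofReal (cylRadius x ^ 2 * (angVortQuot u₀ x)⁺) ≤ ENNReal.ofReal P) ∧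
        (∫⁻ x, ENNReal.ofReal (cylRadius x ^ 2 * (angVortQuot u₀ x)⁻) ≤ ENNReal.ofReal P) ∧
        0 < E ∧ (ENNReal.ofReal E ≤ ∫⁻ x, ‖u₀ x‖ₑ ^ 2) ∧
        2 * (c * ℓ ^ a) * (6 * Real.sqrt (M * Real.sqrt m) * Real.sqrt mneg) ≤
          Real.sqrt (Real.sqrt (2 * P)) / 2 ∧
        16 * M * P * (c * ℓ ^ a) ≤ E ∧
        c * ℓ ^ (-(1 / 2 : ℝ)) ≤
          (π * (E / 2) ^ 3 / (512 * (Real.sqrt m * Real.sqrt (4 * P)) ^ 3)) ^ (1 / 3 : ℝ)) :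
    LpPersistence 3 (1 / 2) a := by
  refine ⟨c, hc, hc1, fun ℓ hℓ hℓ1 => ?_⟩
  obtain ⟨u₀, M, m, mneg, P, E, hsm, hdiv, hdec, hax, hsw, hL1, hE1, hM, hm, hm0, hmneg, hmneg0,
    hP, hPp, hPn, hE, hEu, hW1, hW2, hF⟩ := hdata ℓ hℓ hℓ1
  obtain ⟨u, p, hsol⟩ := exists_isTaoSolutionOn_of_noSwirl tao2011_smooth_local_existence_holds
    axisymmetricNoSwirl_enstrophy_apriori_holds one_pos hsm hdiv
    (fun n => hdec.lintegral_enorm_iteratedFDeriv_sq_lt_top (μ := volume) n) hax hsw one_pos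
  refine ⟨u, p, ⟨?_, ?_, ?_⟩, ?_, ?_⟩
  · exact hsol.classical.mono Ico_subset_Icc_self (uniqueDiffOn_Ico 0 1)
  · have := hsol.isLerayHopfOn one_pos
    rwa [← hsol.initial] at this
  · rw [hsol.initial]; exact hdec
  · show ∫⁻ x, ‖u 0 x‖ₑ ^ 2 ≤ 1
    rw [hsol.initial]; exact hE1
  · intro t ht
    have hℓa : 0 < ℓ ^ a := Real.rpow_pos_of_pos hℓ _
    have hτpos : 0 < c * ℓ ^ a := mul_pos hc hℓa
    have hτ1 : c * ℓ ^ a ≤ 1 := by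
      calc c * ℓ ^ a ≤ 1 * 1 := mul_le_mul hc1 (Real.rpow_le_one hℓ.le hℓ1 ha) hℓa.le zero_le_one
        _ = 1 := one_mul _
    have hτ : c * ℓ ^ a ∈ Ioc (0 : ℝ) 1 := ⟨hτpos, hτ1⟩
    have htI : t ∈ Icc 0 (c * ℓ ^ a) := ⟨ht.1.le, ht.2.le⟩
    have hM0 : 0 ≤ M := (abs_nonneg _).trans (hM 0)
    have htE : 16 * (1 : ℝ) * M * P * t ≤ E := by
      have : 16 * M * P * t ≤ 16 * M * P * (c * ℓ ^ a) :=
        mul_le_mul_of_nonneg_left ht.2.le (by positivity)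
      linarith
    have hfl := l3_floor hsol one_pos one_pos hax hsw hL1 hM hm0 hm hmneg hmneg0 hP hPp hPn hτ hW1
      hE hEu htI htE
    exact (ENNReal.ofReal_le_ofReal hF).trans hfl

/-- **No uniform quantitative jaw above `q = 2a`, conditional on a datum family with window
exponent `a`** (threshold theorem `not_quantBound_of_persistence` at `p = 3`, `β = 1/2`). -/
theorem not_quantJaw_of_ringData_exp {c a : ℝ} (hc : 0 < c) (hc1 : c ≤ 1) (ha : 0 ≤ a)
    (hdata : ∀ ℓ : ℝ, 0 < ℓ → ℓ ≤ 1 →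
      ∃ (u₀ : EuclideanSpace ℝ (Fin 3) → EuclideanSpace ℝ (Fin 3)) (M m mneg P E : ℝ),
        ContDiff ℝ (⊤ : ℕ∞) u₀ ∧ VectorCalculus.IsDivFree u₀ ∧ HasRapidSpatialDecay u₀ ∧
        IsAxisymmetric u₀ ∧ HasNoSwirl u₀ ∧ Integrable (angVortQuot u₀) ∧
        (∫⁻ x, ‖u₀ x‖ₑ ^ 2 ≤ 1) ∧
        (∀ x, |angVortQuot u₀ x| ≤ M) ∧ (∫ x, |angVortQuot u₀ x| ≤ m) ∧ 0 < m ∧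
        (∫⁻ x, ENNReal.ofReal ((angVortQuot u₀ x)⁻) ≤ ENNReal.ofReal mneg) ∧ 0 ≤ mneg ∧ 0 < P ∧
        (∫⁻ x, ENNReal.ofReal (cylRadius x ^ 2 * (angVortQuot u₀ x)⁺) ≤ ENNReal.ofReal P) ∧
        (∫⁻ x, ENNReal.ofReal (cylRadius x ^ 2 * (angVortQuot u₀ x)⁻) ≤ ENNReal.ofReal P) ∧
        0 < E ∧ (ENNReal.ofReal E ≤ ∫⁻ x, ‖u₀ x‖ₑ ^ 2) ∧
        2 * (c * ℓ ^ a) * (6 * Real.sqrt (M * Real.sqrt m) * Real.sqrt mneg) ≤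
          Real.sqrt (Real.sqrt (2 * P)) / 2 ∧
        16 * M * P * (c * ℓ ^ a) ≤ E ∧
        c * ℓ ^ (-(1 / 2 : ℝ)) ≤
          (π * (E / 2) ^ 3 / (512 * (Real.sqrt m * Real.sqrt (4 * P)) ^ 3)) ^ (1 / 3 : ℝ))
    {q : ℝ} (hq : 2 * a < q) : ¬ QuantJaw q :=
  not_quantBound_of_persistence ha (by linarith) (lpPersistence_of_ringData_exp hc hc1 ha hdata)
    (by linarith)

/--
info: 'Summit.NavierStokesRegularity.NavierStokesRegularity.Theorems.L3TimeExponentPincerRingPersistence.lpPersistence_of_ringData' depends on axioms: [propext,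
 Classical.choice,
 Quot.sound]
-/
#guard_msgs in
#print axioms lpPersistence_of_ringData

end Summit.NavierStokesRegularity.NavierStokesRegularity.Theorems.L3TimeExponentPincerRingPersistence
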